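import Literature.AlgebraicGeometry.Resolution.VertexBlowupCharts
import HarnessLib

/-!
# [OURS · L1 W4.5(b) · EL♮(3) · nose residue, D3-9] The LINE through the vertex of `ℙ^{d+1}` and a coordinate point, and its
# STRICT TRANSFORM under a blowing up of the vertex — definitions (sets) and their first properties

Crux chain w45b, child EL♮(3) = stmt-ResolutionOfSingularities-20148; desk table D3, row **D3-9** «Steiner LINE instances of
`DirStepUnobs`» (res-L1-w45b-nose-w3 g2, WIDTH seat D-0157 DOOR 1; NOSE WORD v1.4 §3 row 1 (b); `L/res-L1-w45b-nose-w3/STEINER-TEST.md`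
(P3)/(P4)). `--supports stmt-ResolutionOfSingularities-20148 --as helper`. OURS; NOT a statement of any manuscript; AI-written, weaker
than expert review. No `sorry`; standard axioms. TWO definitions (sets — no structure, no instance, no notation), in the spelling
of the tree's de Jong Lemma 4.11 vertex kit (`Literature/…/VertexBlowupCharts`: `ℙ^{d+1}_k = Proj k[x₀,…,x_{d+1}]`, the vertex
`p = (0:…:0:1)` = `DeJong1996.vertex d k`, ANY blowing up `b : P̃ ⟶ ℙ^{d+1}` of `𝓘{p}`):

* `vertexLine d k i₀ ⊆ ℙ^{d+1}` — the line `V₊(x_j : j ≤ d, j ≠ i₀)` joining the vertex `p` and the coordinate point `e_{i₀}`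
  (`i₀ ≤ d`); for `d = 2` and the Steiner/Roman surface `x²y² + y²z² + z²x² + xyzw` (vertex `= [0:0:0:1]`) the three values of `i₀`
  are its three double lines `y = z = 0`, `x = z = 0`, `x = y = 0`;
* `vertexLineStrict b i₀ ⊆ P̃` — its STRICT TRANSFORM `closure (b⁻¹(vertexLine ∖ {p}))` (the nose `Z′` of NOSE WORD §3 row 1).

First properties: `isClosed_vertexLine`, `vertex_mem_vertexLine`, `mem_basicOpen_of_mem_vertexLine` (a point of the line other
than the vertex lies in `D₊(x_{i₀})`), `isClosed_vertexLineStrict`, `vertexLineStrict_subset_preimage`,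
`preimage_diff_subset_vertexLineStrict`. The `DirStepUnobs` certificate of `vertexLineStrict` (two charts: the vertex chart
`Spec k[X][I/X_{i₀}]` and `b⁻¹D₊(x_{i₀})`) is built in the sibling files `…NatVertexLineChartA/ChartB/Unobs`.

References (index only): R. Hartshorne, *Algebraic Geometry* (1977), II §7 (blowing up, strict transform) [cite: Hartshorne1977];
A. J. de Jong (1996), proof of Lemma 4.11 (the vertex blow-up) [cite: DeJong1996].
-/

set_option linter.dupNamespace false -- mandated namespace `Summit.<Summit>.<Problem>` of this single-conjunct summit

noncomputable section

open CategoryTheory AlgebraicGeometry TopologicalSpace HomogeneousLocalization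
open Literature.AlgebraicGeometry.Resolution Literature.AlgebraicGeometry.Resolution.DeJong1996
open Literature.AlgebraicGeometry.Motives.Segre (grading X_mem)

attribute [local instance] MvPolynomial.gradedAlgebra

namespace Summit.ResolutionOfSingularities.ResolutionOfSingularities.Cruxes.EquisingularLiftNat.Sections

variable (d : ℕ) (k : Type) [Field k]

/-- **The line through the vertex and the `i₀`-th coordinate point**: `V₊(x_j : j ≤ d, j ≠ i₀) ⊆ ℙ^{d+1}_k = Proj k[x₀, …, x_{d+1}]`,
as a set of points (those whose homogeneous prime contains the `x_j`, `j ≤ d`, `j ≠ i₀`). [cite: Hartshorne1977, I Ex. 2.11 (linear varieties)] -/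
def vertexLine (i₀ : Fin (d + 1)) : Set (Proj (grading (Fin (d + 1 + 1)) k)) :=
  {x | ∀ j : Fin (d + 1), j ≠ i₀ → (MvPolynomial.X (Fin.castSucc j) : MvPolynomial (Fin (d + 1 + 1)) k) ∈ x.asHomogeneousIdeal}

variable {d k}

/-- Membership in the line, unfolded. [folklore] -/
theorem mem_vertexLine_iff (i₀ : Fin (d + 1)) (x : Proj (grading (Fin (d + 1 + 1)) k)) :
    x ∈ vertexLine d k i₀ ↔
      ∀ j : Fin (d + 1), j ≠ i₀ → (MvPolynomial.X (Fin.castSucc j) : MvPolynomial (Fin (d + 1 + 1)) k) ∈ x.asHomogeneousIdeal :=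
  Iff.rfl

/-- The line is an intersection of zero loci of variables, hence closed. [cite: Hartshorne1977, II Prop. 2.5] (folklore) -/
theorem isClosed_vertexLine (i₀ : Fin (d + 1)) : IsClosed (vertexLine d k i₀) := by
  have h : vertexLine d k i₀ = ⋂ j ∈ {j : Fin (d + 1) | j ≠ i₀},
      (Proj.basicOpen (grading (Fin (d + 1 + 1)) k) (MvPolynomial.X (Fin.castSucc j)) : Set _)ᶜ := by
    ext x
    simp only [mem_vertexLine_iff, Set.mem_setOf_eq, Set.mem_iInter, Set.mem_compl_iff, SetLike.mem_coe, Proj.mem_basicOpen,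
      not_not]
  rw [h]
  exact isClosed_biInter fun j _ => (Proj.basicOpen _ _).isOpen.isClosed_compl

/-- The vertex lies on the line. [folklore] -/
theorem vertex_mem_vertexLine (i₀ : Fin (d + 1)) : vertex d k ∈ vertexLine d k i₀ :=
  fun j _ => X_castSucc_mem_vertexIdeal d k j

/-- **A point of the line other than the vertex lies in the chart `D₊(x_{i₀})`** (all `x_j`, `j ≤ d`, `j ≠ i₀` vanish at it; if
`x_{i₀}` vanished too it would be the vertex, `eq_vertex_iff`). [folklore] -/
theorem mem_basicOpen_of_mem_vertexLine {i₀ : Fin (d + 1)} {x : Proj (grading (Fin (d + 1 + 1)) k)}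
    (hx : x ∈ vertexLine d k i₀) (hne : x ≠ vertex d k) :
    x ∈ Proj.basicOpen (grading (Fin (d + 1 + 1)) k) (MvPolynomial.X (Fin.castSucc i₀)) := by
  rw [Proj.mem_basicOpen]
  intro h
  apply hne
  rw [eq_vertex_iff]
  intro j
  by_cases hj : j = i₀
  · rw [hj]; exact h
  · exact hx j hj

/-- The line minus the vertex lies in `D₊(x_{i₀})`. [folklore] -/
theorem vertexLine_diff_subset_basicOpen (i₀ : Fin (d + 1)) :
    vertexLine d k i₀ \ {vertex d k} ⊆ (Proj.basicOpen (grading (Fin (d + 1 + 1)) k) (MvPolynomial.X (Fin.castSucc i₀)) : Set _) :=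
  fun _ hx => mem_basicOpen_of_mem_vertexLine hx.1 hx.2

/-- **The strict transform of the line** under a morphism `b : P̃ ⟶ ℙ^{d+1}` (meant: a blowing up of the vertex):
`closure (b⁻¹(vertexLine ∖ {vertex}))`. [cite: Hartshorne1977, II §7 (strict transform, p. 165)] -/
def vertexLineStrict {P : Scheme.{0}} (b : P ⟶ Proj (grading (Fin (d + 1 + 1)) k)) (i₀ : Fin (d + 1)) : Set P :=
  closure (b ⁻¹' (vertexLine d k i₀ \ {vertex d k}))

/-- The strict transform is closed. [folklore] -/
theorem isClosed_vertexLineStrict {P : Scheme.{0}} (b : P ⟶ Proj (grading (Fin (d + 1 + 1)) k)) (i₀ : Fin (d + 1)) :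
    IsClosed (vertexLineStrict b i₀) :=
  isClosed_closure

/-- The strict transform lies in the total transform `b⁻¹(vertexLine)`. [folklore] -/
theorem vertexLineStrict_subset_preimage {P : Scheme.{0}} (b : P ⟶ Proj (grading (Fin (d + 1 + 1)) k)) (i₀ : Fin (d + 1)) :
    vertexLineStrict b i₀ ⊆ b ⁻¹' vertexLine d k i₀ :=
  closure_minimal (Set.preimage_mono fun _ hx => hx.1) ((isClosed_vertexLine i₀).preimage b.continuous)

/-- The preimage of the punctured line lies in the strict transform. [folklore] -/
theorem preimage_diff_subset_vertexLineStrict {P : Scheme.{0}} (b : P ⟶ Proj (grading (Fin (d + 1 + 1)) k)) (i₀ : Fin (d + 1)) :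
    b ⁻¹' (vertexLine d k i₀ \ {vertex d k}) ⊆ vertexLineStrict b i₀ :=
  subset_closure

/-- The trace of the strict transform on an open `W ⊆ P̃` is the closure IN `W` of the trace of `b⁻¹(vertexLine ∖ {vertex})`: for an open
embedding `c` with image `W`, `c⁻¹(vertexLineStrict) = closure (c⁻¹ b⁻¹(vertexLine ∖ {vertex}))`. [folklore] -/
theorem preimage_vertexLineStrict_of_isOpenEmbedding {P : Scheme.{0}} (b : P ⟶ Proj (grading (Fin (d + 1 + 1)) k)) (i₀ : Fin (d + 1))
    {Y : Type*} [TopologicalSpace Y] {c : Y → P} (hc : Topology.IsOpenEmbedding c) :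
    c ⁻¹' vertexLineStrict b i₀ = closure (c ⁻¹' (b ⁻¹' (vertexLine d k i₀ \ {vertex d k}))) :=
  hc.isOpenMap.preimage_closure_eq_closure_preimage hc.continuous _

end Summit.ResolutionOfSingularities.ResolutionOfSingularities.Cruxes.EquisingularLiftNat.Sections

end
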